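import Literature.AlgebraicGeometry.FundamentalGroup.ProjectiveLineSimplyConnectedHolds
import Literature.AlgebraicGeometry.FundamentalGroup.EtaleCoverHyperplaneSectionConnectedHolds
import HarnessLib

/-!
# `ℙ^r_k` is simply connected (SGA 1 XI 1.1) — the named fact discharged

Topic: `Literature/AlgebraicGeometry/Resolution`. Discharge of the named fact
`ProjectiveSpaceSimplyConnected` (`AlterationsFibresConnected.lean`; used in de Jong 1996, 4.12,
p. 68, "`ℙ^{d-1}` is simply connected", to see that the finite étale part `Y' → ℙ^{d-1}` of the
Stein factorisation is an isomorphism): a connected finite étale cover of `ℙ^r_k`, `k`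
algebraically closed, is trivial.

This is pure composition of results already in the tree, following the printed proof of SGA 1,
Exp. XI, Prop. 1.1 (induction on `r`): the assembly
`ProjectiveSpaceSimplyConnected.of_projectiveLine_of_hyperplaneSection`
(`FundamentalGroup/ProjectiveSpace.lean`) fed with the two discharged leaves
`ProjectiveLineSimplyConnected_holds` (the case `r = 1`, Riemann–Hurwitz;
`FundamentalGroup/ProjectiveLineSimplyConnectedHolds.lean`) and
`EtaleCoverHyperplaneSectionConnected_holds` (SGA 1 X 2.11 for the hyperplane `ℙ^{r+1} ⊂ ℙ^{r+2}`;
`FundamentalGroup/EtaleCoverHyperplaneSectionConnectedHolds.lean`).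

## Sources

* A. Grothendieck, M. Raynaud, SGA 1, Exp. XI, Prop. 1.1 (with Exp. X, Cor. 2.11). [SGA1]
* A. J. de Jong, *Smoothness, semi-stability and alterations*, Publ. Math. IHÉS 83 (1996),
  4.12, p. 68. [DeJong1996]
-/

noncomputable section

namespace Literature.AlgebraicGeometry.Resolution

universe u

open Literature.AlgebraicGeometry.FundamentalGroup (ProjectiveLineSimplyConnected_holds
  EtaleCoverHyperplaneSectionConnected_holds)

/-- **SGA 1, Exp. XI, Prop. 1.1**: `ℙ^r_k` (`k` algebraically closed) is simply connected — every
connected finite étale cover `Y → ℙ^r_k` is an isomorphism; the named fact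
`ProjectiveSpaceSimplyConnected` holds. Proof as printed: induction on `r` from the case `r = 1`
and X 2.11. [cite: SGA1, Exp. XI Prop. 1.1] [cite: DeJong1996, 4.12, p. 68] -/
theorem ProjectiveSpaceSimplyConnected_holds : ProjectiveSpaceSimplyConnected.{u} :=
  ProjectiveSpaceSimplyConnected.of_projectiveLine_of_hyperplaneSection
    ProjectiveLineSimplyConnected_holds EtaleCoverHyperplaneSectionConnected_holds

end Literature.AlgebraicGeometry.Resolution

end
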